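import Summits.AtomisticToContinuum.Crystallization.Theses.FluxTubeKepler
import Summits.AtomisticToContinuum.Crystallization.Theorems.ChargedEnergyGap.Negative.Unconditional

/-!
# `FluxCellKepler` (stmt-AtomisticToContinuum-15221), line `Sketch` — necessary conditions on a witness of `stub_coerciveFluxCells`

The line's bet `stub_coerciveFluxCells` (`Cruxes/FluxCellKepler/Lines/Sketch.lean`) asks for a
pattern radius `R₁` and a LOCAL tail credit `τ : Finset ℝ³ → ℝ` with

* (DOM) `Σ_i site₆(x)_i ≤ Σ_i τ(pattern_i)` on EVERY finite injective configuration `x` of `ℝ³`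
  (`pattern_i = {x_j − x_i : dist (x_j, x_i) ≤ R₁}`), and
* (COERCIVE) for every `δ > 0` some `θ < 1` with
  `Σ_i τ(pattern_i) − Σ_i site₆(x)_i ≤ 12 θ (E_LJ(x) − N · e⋆)` on every `δ`-separated finite
  injective `x`, `e⋆ = ⨅_Q e(Q)` over periodic `Q`.

Nothing in the tree supplies the intended witness (flux-tube / Thomson energies over Voronoi
cells; the support item `FluxTubeBound`, stmt-AtomisticToContinuum-15225, is open).  This file
certifies NECESSARY CONDITIONS on any witness `(R₁, τ)` and any admissible `θ` (the inner clause of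
COERCIVE at one `δ`), obtained from the one- and two-point configurations — concrete targets for the
crux disprover, in the spirit of §2 of `Cruxes/FluxCellKepler/Disproof.lean`:

* `dom_R₁_pos`, `dom_inv_pow_six_le_tau_zero`, `dom_inv_R₁_pow_six_le_tau_zero`: DOM alone forces
  `0 < R₁` and `d⁻⁶ ≤ τ {0}` for every `d > R₁`, hence `R₁⁻⁶ ≤ τ {0}` (two points at distance `d`:
  both patterns are the isolated pattern `{0}`, both site energies are `d⁻⁶`).
* `coercive_tau_zero_le`: the `θ`-clause (any `δ`, given `θ`, `0 ≤ R₁`) on ONE point forces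
  `τ {0} ≤ 12 θ (−e⋆)` (site energies and `E_LJ` vanish, `N = 1`).
* `witness_inv_R₁_pow_six_le`, `witness_eStar_neg`, `witness_theta_pos`, `witness_theta_ge`:
  together, `R₁⁻⁶ ≤ 12 θ (−e⋆)`, `e⋆ < 0`, `0 < θ` and `θ ≥ R₁⁻⁶ / (12 |e⋆|)` — the contraction
  factor `θ` of the stub can NOT be taken small: it is tied to the pattern radius by the energy
  scale.  (`e⋆ ≤ 0` is read off the tree's floor `N · e⋆ ≤ E_LJ` at `N = 1`,
  `ChargedEnergyGapNegative.card_mul_eStar_le`.)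
-/

namespace Summit.AtomisticToContinuum.Crystallization.Theorems.FluxCellKeplerSketchCoercive

open scoped BigOperators
open Literature.MathematicalPhysics.StatisticalMechanics
open Summit.AtomisticToContinuum.Crystallization.Theorems.ChargedEnergyGapNegative (eStar
  card_mul_eStar_le)

/-! ## Private lemmas: two points at distance `d`, one point -/

/-- A two-point configuration of `ℝ³` at mutual distance `d > 0` exists and is injective.
[folklore] -/
private theorem exists_twoPt {d : ℝ} (hd : 0 < d) :
    ∃ x : Fin 2 → EuclideanSpace ℝ (Fin 3), Function.Injective x ∧
      ∀ i j : Fin 2, i ≠ j → dist (x i) (x j) = d := by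
  obtain ⟨v, hv⟩ : ∃ v : EuclideanSpace ℝ (Fin 3), ‖v‖ = d := by
    refine ⟨d • EuclideanSpace.single 0 1, ?_⟩
    rw [norm_smul, EuclideanSpace.single, PiLp.norm_single, norm_one, mul_one,
      Real.norm_of_nonneg hd.le]
  have hdist : ∀ i j : Fin 2, i ≠ j →
      dist ((![0, v] : Fin 2 → EuclideanSpace ℝ (Fin 3)) i) (![0, v] j) = d := by
    intro i j hij
    fin_cases i <;> fin_cases j
    · exact absurd rfl hij
    · show dist (0 : EuclideanSpace ℝ (Fin 3)) v = d
      rw [dist_comm, dist_zero_right, hv]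
    · show dist v (0 : EuclideanSpace ℝ (Fin 3)) = d
      rw [dist_zero_right, hv]
    · exact absurd rfl hij
  refine ⟨![0, v], fun i j h => ?_, hdist⟩
  by_contra hne
  have h' := hdist i j hne
  rw [h, dist_self] at h'
  exact hd.ne' h'.symm

/-- In a two-point configuration at mutual distance `d > R₁` both `R₁`-patterns are the isolated
pattern (`{0}` if `0 ≤ R₁`, `∅` otherwise). [folklore] -/
private theorem pat_of_dist_eq {R₁ d : ℝ} {x : Fin 2 → EuclideanSpace ℝ (Fin 3)}
    (hx : ∀ i j : Fin 2, i ≠ j → dist (x i) (x j) = d) (hRd : R₁ < d) (i : Fin 2) :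
    ((Finset.univ.filter fun j : Fin 2 => dist (x j) (x i) ≤ R₁).image fun j => x j - x i)
      = if 0 ≤ R₁ then {0} else ∅ := by
  by_cases hR : 0 ≤ R₁
  · have hfilter : (Finset.univ.filter fun j : Fin 2 => dist (x j) (x i) ≤ R₁) = {i} := by
      ext j
      simp only [Finset.mem_filter, Finset.mem_univ, true_and, Finset.mem_singleton]
      constructor
      · intro hj
        by_contra hne
        have := hx j i hne
        linarith
      · rintro rfl
        simpa using hR
    rw [hfilter, Finset.image_singleton, sub_self, if_pos hR]
  · have hfilter : (Finset.univ.filter fun j : Fin 2 => dist (x j) (x i) ≤ R₁) = ∅ := by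
      ext j
      simp only [Finset.mem_filter, Finset.mem_univ, true_and, Finset.notMem_empty, iff_false,
        not_le]
      exact (not_le.1 hR).trans_le dist_nonneg
    rw [hfilter, Finset.image_empty, if_neg hR]

/-- Site energies of a two-point configuration at mutual distance `d` for an inverse power.
[folklore] -/
private theorem siteEnergy_of_dist_eq {d : ℝ} {x : Fin 2 → EuclideanSpace ℝ (Fin 3)}
    (hx : ∀ i j : Fin 2, i ≠ j → dist (x i) (x j) = d) (n : ℕ) :
    ∀ i : Fin 2, siteEnergy (fun r => (r⁻¹) ^ n) x i = (d⁻¹) ^ n := by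
  unfold siteEnergy
  have h0 : (Finset.univ.erase (0 : Fin 2)) = {1} := by decide
  have h1 : (Finset.univ.erase (1 : Fin 2)) = {0} := by decide
  simp only [Fin.forall_fin_two, h0, h1, Finset.sum_singleton]
  rw [hx 0 1 (by decide), hx 1 0 (by decide)]
  exact ⟨rfl, rfl⟩

/-! ## (a) Consequences of DOM: two-point configurations -/

/-- **DOM on two points at distance `d > R₁`, `d > 0`:** `d⁻⁶ ≤ τ(isolated pattern)`.
[folklore] -/
theorem dom_inv_pow_six_le {R₁ : ℝ} {τ : Finset (EuclideanSpace ℝ (Fin 3)) → ℝ}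
    (hDom : ∀ (N : ℕ) (x : Fin N → EuclideanSpace ℝ (Fin 3)), Function.Injective x →
        ∑ i, siteEnergy (fun r => (r⁻¹) ^ 6) x i
          ≤ ∑ i, τ ((Finset.univ.filter fun j : Fin N => dist (x j) (x i) ≤ R₁).image
              fun j => x j - x i))
    {d : ℝ} (hd : 0 < d) (hRd : R₁ < d) :
    (d⁻¹) ^ 6 ≤ τ (if 0 ≤ R₁ then {0} else ∅) := by
  obtain ⟨x, hinj, hx⟩ := exists_twoPt hd
  have h := hDom 2 x hinj
  simp only [Fin.sum_univ_two, siteEnergy_of_dist_eq hx, pat_of_dist_eq hx hRd] at h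
  linarith

/-- **Any DOM-witness has `0 < R₁`:** otherwise every two-point configuration at a small distance
`d` has isolated patterns and `d⁻⁶ ≤ τ(isolated pattern)` for all small `d > 0`, absurd.
[folklore] -/
theorem dom_R₁_pos {R₁ : ℝ} {τ : Finset (EuclideanSpace ℝ (Fin 3)) → ℝ}
    (hDom : ∀ (N : ℕ) (x : Fin N → EuclideanSpace ℝ (Fin 3)), Function.Injective x →
        ∑ i, siteEnergy (fun r => (r⁻¹) ^ 6) x i
          ≤ ∑ i, τ ((Finset.univ.filter fun j : Fin N => dist (x j) (x i) ≤ R₁).image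
              fun j => x j - x i)) :
    0 < R₁ := by
  by_contra hR
  rw [not_lt] at hR
  set T := τ (if 0 ≤ R₁ then {0} else ∅)
  set d : ℝ := 1 / (|T| + 2) with hd_def
  have hT2 : 0 < |T| + 2 := by positivity
  have hd : 0 < d := by positivity
  have hd1 : d ≤ 1 := by
    rw [hd_def, div_le_one hT2]; linarith [abs_nonneg T]
  have h1 : (d⁻¹) ^ 6 ≤ T := dom_inv_pow_six_le hDom hd (hR.trans_lt hd)
  have h2 : d⁻¹ ≤ (d⁻¹) ^ 6 := le_self_pow₀ (one_le_inv₀ hd |>.2 hd1) (by norm_num)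
  have h3 : d⁻¹ = |T| + 2 := by rw [hd_def, one_div, inv_inv]
  linarith [le_abs_self T]

/-- **DOM squeeze, lower side:** `d⁻⁶ ≤ τ {0}` for every `d > R₁`. [folklore] -/
theorem dom_inv_pow_six_le_tau_zero {R₁ : ℝ} {τ : Finset (EuclideanSpace ℝ (Fin 3)) → ℝ}
    (hDom : ∀ (N : ℕ) (x : Fin N → EuclideanSpace ℝ (Fin 3)), Function.Injective x →
        ∑ i, siteEnergy (fun r => (r⁻¹) ^ 6) x i
          ≤ ∑ i, τ ((Finset.univ.filter fun j : Fin N => dist (x j) (x i) ≤ R₁).image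
              fun j => x j - x i))
    {d : ℝ} (hRd : R₁ < d) : (d⁻¹) ^ 6 ≤ τ {0} := by
  have hR := dom_R₁_pos hDom
  have h := dom_inv_pow_six_le hDom (hR.trans hRd) hRd
  rwa [if_pos hR.le] at h

/-- **DOM squeeze at the pattern radius:** `R₁⁻⁶ ≤ τ {0}` (let `d ↓ R₁`). [folklore] -/
theorem dom_inv_R₁_pow_six_le_tau_zero {R₁ : ℝ} {τ : Finset (EuclideanSpace ℝ (Fin 3)) → ℝ}
    (hDom : ∀ (N : ℕ) (x : Fin N → EuclideanSpace ℝ (Fin 3)), Function.Injective x →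
        ∑ i, siteEnergy (fun r => (r⁻¹) ^ 6) x i
          ≤ ∑ i, τ ((Finset.univ.filter fun j : Fin N => dist (x j) (x i) ≤ R₁).image
              fun j => x j - x i)) :
    (R₁⁻¹) ^ 6 ≤ τ {0} := by
  have hR := dom_R₁_pos hDom
  have hcont : ContinuousAt (fun d : ℝ => (d⁻¹) ^ 6) R₁ := (continuousAt_inv₀ hR.ne').pow 6
  have htend : Filter.Tendsto (fun d : ℝ => (d⁻¹) ^ 6) (nhdsWithin R₁ (Set.Ioi R₁))
      (nhds ((R₁⁻¹) ^ 6)) := hcont.continuousWithinAt.tendsto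
  refine le_of_tendsto htend ?_
  exact eventually_nhdsWithin_of_forall fun d hd => dom_inv_pow_six_le_tau_zero hDom hd

/-! ## (b) Consequence of the `θ`-clause: the one-point configuration -/

/-- **The `θ`-clause on one point:** if the over-credit bound
`Σ τ − Σ site₆ ≤ 12 θ (E_LJ − N e⋆)` holds on all `δ`-separated finite injective configurations
(for some `δ` and a given `θ`) and `0 ≤ R₁`, then `τ {0} ≤ 12 θ (−e⋆)`: on the single site the
pattern is `{0}`, the site energy and `E_LJ` vanish and `N = 1`. [folklore] -/
theorem coercive_tau_zero_le {R₁ δ θ : ℝ} {τ : Finset (EuclideanSpace ℝ (Fin 3)) → ℝ}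
    (hθ : ∀ (N : ℕ) (x : Fin N → EuclideanSpace ℝ (Fin 3)), Function.Injective x →
        (∀ i j, i ≠ j → δ ≤ dist (x i) (x j)) →
        ∑ i, τ ((Finset.univ.filter fun j : Fin N => dist (x j) (x i) ≤ R₁).image
            fun j => x j - x i)
            - ∑ i, siteEnergy (fun r => (r⁻¹) ^ 6) x i
          ≤ 12 * θ * (interactionEnergy lennardJones x
              - (N : ℝ) * ⨅ Q : PeriodicConfiguration 3, Q.energyPerParticle lennardJones))
    (hR : 0 ≤ R₁) :
    τ {0} ≤ 12 * θ * -(⨅ Q : PeriodicConfiguration 3, Q.energyPerParticle lennardJones) := by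
  obtain ⟨x₁, hx₁⟩ : ∃ x₁ : Fin 1 → EuclideanSpace ℝ (Fin 3), ∀ i, x₁ i = 0 :=
    ⟨fun _ => 0, fun _ => rfl⟩
  have hinj : Function.Injective x₁ := fun i j _ => Subsingleton.elim i j
  have hsep : ∀ i j : Fin 1, i ≠ j → δ ≤ dist (x₁ i) (x₁ j) :=
    fun i j hij => absurd (Subsingleton.elim i j) hij
  have h0 := hθ 1 x₁ hinj hsep
  have hfilt : (Finset.univ.filter fun j : Fin 1 => dist (x₁ j) (x₁ 0) ≤ R₁) = Finset.univ := by
    ext j; simp [hx₁, hR]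
  have hpat : ((Finset.univ.filter fun j : Fin 1 => dist (x₁ j) (x₁ 0) ≤ R₁).image
      fun j => x₁ j - x₁ 0) = {0} := by
    rw [hfilt]; ext p; simp [hx₁]
  have hsite : siteEnergy (fun r => (r⁻¹) ^ 6) x₁ 0 = 0 := by
    unfold siteEnergy
    have : (Finset.univ.erase (0 : Fin 1)) = ∅ := by decide
    rw [this, Finset.sum_empty]
  have hE : interactionEnergy lennardJones x₁ = 0 := interactionEnergy_of_subsingleton _ _
  simp only [Fin.sum_univ_one, hsite, hE, hpat, sub_zero, zero_sub, Nat.cast_one, one_mul,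
    mul_neg] at h0
  simpa [mul_neg] using h0

/-! ## (c) Both together: `θ` is tied to `R₁` by the energy scale -/

/-- **`R₁⁻⁶ ≤ 12 θ (−e⋆)` for any witness:** DOM gives `R₁⁻⁶ ≤ τ {0}` and the `θ`-clause gives
`τ {0} ≤ 12 θ (−e⋆)`. [folklore] -/
theorem witness_inv_R₁_pow_six_le {R₁ δ θ : ℝ} {τ : Finset (EuclideanSpace ℝ (Fin 3)) → ℝ}
    (hDom : ∀ (N : ℕ) (x : Fin N → EuclideanSpace ℝ (Fin 3)), Function.Injective x →
        ∑ i, siteEnergy (fun r => (r⁻¹) ^ 6) x i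
          ≤ ∑ i, τ ((Finset.univ.filter fun j : Fin N => dist (x j) (x i) ≤ R₁).image
              fun j => x j - x i))
    (hθ : ∀ (N : ℕ) (x : Fin N → EuclideanSpace ℝ (Fin 3)), Function.Injective x →
        (∀ i j, i ≠ j → δ ≤ dist (x i) (x j)) →
        ∑ i, τ ((Finset.univ.filter fun j : Fin N => dist (x j) (x i) ≤ R₁).image
            fun j => x j - x i)
            - ∑ i, siteEnergy (fun r => (r⁻¹) ^ 6) x i
          ≤ 12 * θ * (interactionEnergy lennardJones x
              - (N : ℝ) * ⨅ Q : PeriodicConfiguration 3, Q.energyPerParticle lennardJones)) :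
    (R₁⁻¹) ^ 6 ≤ 12 * θ * -(⨅ Q : PeriodicConfiguration 3, Q.energyPerParticle lennardJones) :=
  (dom_inv_R₁_pow_six_le_tau_zero hDom).trans (coercive_tau_zero_le hθ (dom_R₁_pos hDom).le)

/-- The floor at one point: `e⋆ = ⨅_Q e(Q) ≤ 0` (the tree's `N · e⋆ ≤ E_LJ(y)` at `N = 1`, where
`E_LJ = 0`). [folklore] -/
theorem iInf_energyPerParticle_nonpos :
    (⨅ Q : PeriodicConfiguration 3, Q.energyPerParticle lennardJones) ≤ 0 := by
  have hinj : Function.Injective (fun _ : Fin 1 => (0 : EuclideanSpace ℝ (Fin 3))) :=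
    fun i j _ => Subsingleton.elim i j
  have h := card_mul_eStar_le hinj
  rw [interactionEnergy_of_subsingleton, Nat.cast_one, one_mul] at h
  exact h

/-- **Any witness forces `e⋆ < 0`:** `0 < (R₁ + 1)⁻⁶ ≤ τ {0} ≤ 12 θ (−e⋆)` rules out `e⋆ = 0`,
and `e⋆ ≤ 0` by the one-point floor. [folklore] -/
theorem witness_eStar_neg {R₁ δ θ : ℝ} {τ : Finset (EuclideanSpace ℝ (Fin 3)) → ℝ}
    (hDom : ∀ (N : ℕ) (x : Fin N → EuclideanSpace ℝ (Fin 3)), Function.Injective x →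
        ∑ i, siteEnergy (fun r => (r⁻¹) ^ 6) x i
          ≤ ∑ i, τ ((Finset.univ.filter fun j : Fin N => dist (x j) (x i) ≤ R₁).image
              fun j => x j - x i))
    (hθ : ∀ (N : ℕ) (x : Fin N → EuclideanSpace ℝ (Fin 3)), Function.Injective x →
        (∀ i j, i ≠ j → δ ≤ dist (x i) (x j)) →
        ∑ i, τ ((Finset.univ.filter fun j : Fin N => dist (x j) (x i) ≤ R₁).image
            fun j => x j - x i)
            - ∑ i, siteEnergy (fun r => (r⁻¹) ^ 6) x i
          ≤ 12 * θ * (interactionEnergy lennardJones x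
              - (N : ℝ) * ⨅ Q : PeriodicConfiguration 3, Q.energyPerParticle lennardJones)) :
    (⨅ Q : PeriodicConfiguration 3, Q.energyPerParticle lennardJones) < 0 := by
  have hR := dom_R₁_pos hDom
  have h1 := dom_inv_pow_six_le_tau_zero hDom (lt_add_one R₁)
  have h2 := coercive_tau_zero_le hθ hR.le
  have h3 : 0 < ((R₁ + 1)⁻¹) ^ 6 := by positivity
  have h0 := iInf_energyPerParticle_nonpos
  rcases h0.lt_or_eq with h | h
  · exact h
  · exfalso
    rw [h, neg_zero, mul_zero] at h2
    linarith

/-- **Any witness forces `0 < θ`:** the contraction factor of the stub cannot be non-positive,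
since `0 < R₁⁻⁶ ≤ 12 θ (−e⋆)` with `−e⋆ > 0`. [folklore] -/
theorem witness_theta_pos {R₁ δ θ : ℝ} {τ : Finset (EuclideanSpace ℝ (Fin 3)) → ℝ}
    (hDom : ∀ (N : ℕ) (x : Fin N → EuclideanSpace ℝ (Fin 3)), Function.Injective x →
        ∑ i, siteEnergy (fun r => (r⁻¹) ^ 6) x i
          ≤ ∑ i, τ ((Finset.univ.filter fun j : Fin N => dist (x j) (x i) ≤ R₁).image
              fun j => x j - x i))
    (hθ : ∀ (N : ℕ) (x : Fin N → EuclideanSpace ℝ (Fin 3)), Function.Injective x →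
        (∀ i j, i ≠ j → δ ≤ dist (x i) (x j)) →
        ∑ i, τ ((Finset.univ.filter fun j : Fin N => dist (x j) (x i) ≤ R₁).image
            fun j => x j - x i)
            - ∑ i, siteEnergy (fun r => (r⁻¹) ^ 6) x i
          ≤ 12 * θ * (interactionEnergy lennardJones x
              - (N : ℝ) * ⨅ Q : PeriodicConfiguration 3, Q.energyPerParticle lennardJones)) :
    0 < θ := by
  have hR := dom_R₁_pos hDom
  have h1 := witness_inv_R₁_pow_six_le hDom hθ
  have he := witness_eStar_neg hDom hθ
  have h3 : 0 < (R₁⁻¹) ^ 6 := by positivity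
  set e := (⨅ Q : PeriodicConfiguration 3, Q.energyPerParticle lennardJones) with he_def
  have h4 : 0 < θ * (12 * -e) := by linarith
  have h5 : 0 < 12 * -e := by linarith
  exact pos_of_mul_pos_left h4 h5.le

/-- **The contraction factor is bounded below by the pattern radius:**
`R₁⁻⁶ / (12 (−e⋆)) ≤ θ` (with `−e⋆ > 0`), i.e. `θ` cannot be taken small. [folklore] -/
theorem witness_theta_ge {R₁ δ θ : ℝ} {τ : Finset (EuclideanSpace ℝ (Fin 3)) → ℝ}
    (hDom : ∀ (N : ℕ) (x : Fin N → EuclideanSpace ℝ (Fin 3)), Function.Injective x →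
        ∑ i, siteEnergy (fun r => (r⁻¹) ^ 6) x i
          ≤ ∑ i, τ ((Finset.univ.filter fun j : Fin N => dist (x j) (x i) ≤ R₁).image
              fun j => x j - x i))
    (hθ : ∀ (N : ℕ) (x : Fin N → EuclideanSpace ℝ (Fin 3)), Function.Injective x →
        (∀ i j, i ≠ j → δ ≤ dist (x i) (x j)) →
        ∑ i, τ ((Finset.univ.filter fun j : Fin N => dist (x j) (x i) ≤ R₁).image
            fun j => x j - x i)
            - ∑ i, siteEnergy (fun r => (r⁻¹) ^ 6) x i
          ≤ 12 * θ * (interactionEnergy lennardJones x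
              - (N : ℝ) * ⨅ Q : PeriodicConfiguration 3, Q.energyPerParticle lennardJones)) :
    (R₁⁻¹) ^ 6 / (12 * -(⨅ Q : PeriodicConfiguration 3, Q.energyPerParticle lennardJones))
      ≤ θ := by
  have h1 := witness_inv_R₁_pow_six_le hDom hθ
  have he := witness_eStar_neg hDom hθ
  set e := (⨅ Q : PeriodicConfiguration 3, Q.energyPerParticle lennardJones) with he_def
  have h5 : 0 < 12 * -e := by linarith
  rw [div_le_iff₀ h5]
  linarith

/-- **Summary for the stub's second conjunct as registered** (`∀ δ > 0, ∃ θ < 1, …`): together with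
DOM, every `δ > 0` admits a contraction factor only in the window
`R₁⁻⁶ / (12 (−e⋆)) ≤ θ < 1`; in particular `R₁⁻⁶ < 12 (−e⋆)`. [folklore] -/
theorem witness_theta_window {R₁ : ℝ} {τ : Finset (EuclideanSpace ℝ (Fin 3)) → ℝ}
    (hDom : ∀ (N : ℕ) (x : Fin N → EuclideanSpace ℝ (Fin 3)), Function.Injective x →
        ∑ i, siteEnergy (fun r => (r⁻¹) ^ 6) x i
          ≤ ∑ i, τ ((Finset.univ.filter fun j : Fin N => dist (x j) (x i) ≤ R₁).image
              fun j => x j - x i))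
    (hCoer : ∀ δ : ℝ, 0 < δ → ∃ θ : ℝ, θ < 1 ∧
        ∀ (N : ℕ) (x : Fin N → EuclideanSpace ℝ (Fin 3)), Function.Injective x →
          (∀ i j, i ≠ j → δ ≤ dist (x i) (x j)) →
          ∑ i, τ ((Finset.univ.filter fun j : Fin N => dist (x j) (x i) ≤ R₁).image
              fun j => x j - x i)
              - ∑ i, siteEnergy (fun r => (r⁻¹) ^ 6) x i
            ≤ 12 * θ * (interactionEnergy lennardJones x
                - (N : ℝ) * ⨅ Q : PeriodicConfiguration 3, Q.energyPerParticle lennardJones)) :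
    (∀ δ : ℝ, 0 < δ → ∃ θ : ℝ,
        (R₁⁻¹) ^ 6 / (12 * -(⨅ Q : PeriodicConfiguration 3, Q.energyPerParticle lennardJones))
          ≤ θ ∧ 0 < θ ∧ θ < 1) ∧
      (R₁⁻¹) ^ 6 < 12 * -(⨅ Q : PeriodicConfiguration 3, Q.energyPerParticle lennardJones) := by
  refine ⟨fun δ hδ => ?_, ?_⟩
  · obtain ⟨θ, hθ1, hθ⟩ := hCoer δ hδ
    exact ⟨θ, witness_theta_ge hDom hθ, witness_theta_pos hDom hθ, hθ1⟩
  · obtain ⟨θ, hθ1, hθ⟩ := hCoer 1 one_pos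
    have h1 := witness_inv_R₁_pow_six_le hDom hθ
    have he := witness_eStar_neg hDom hθ
    set e := (⨅ Q : PeriodicConfiguration 3, Q.energyPerParticle lennardJones) with he_def
    have h5 : 0 < 12 * -e := by linarith
    nlinarith

/-! ## Registered summary (sub-goal `stub_coerciveWitnessConstraints` of stmt-AtomisticToContinuum-15221) -/

/-- **Necessary conditions on a witness of `stub_coerciveFluxCells`, packaged.** For every pattern
radius `R₁` and local credit `τ` satisfying DOM, and every `δ, θ` for which the over-credit clause
`Σ τ − Σ site₆ ≤ 12 θ (E_LJ − N e⋆)` holds on `δ`-separated finite injective configurations: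
`0 < R₁`; `d⁻⁶ ≤ τ {0}` for all `d > R₁`; `τ {0} ≤ 12 θ (−e⋆)`; `e⋆ < 0`; `0 < θ`; and
`R₁⁻⁶ / (12 (−e⋆)) ≤ θ`.  (One- and two-point configurations; `e⋆ = ⨅_Q e(Q)`.) [folklore] -/
theorem stub_coerciveWitnessConstraints : ∀ (R₁ : ℝ) (τ : Finset (EuclideanSpace ℝ (Fin 3)) → ℝ), (∀ (N : ℕ) (x : Fin N → EuclideanSpace ℝ (Fin 3)), Function.Injective x → ∑ i, siteEnergy (fun r => (r⁻¹) ^ 6) x i ≤ ∑ i, τ ((Finset.univ.filter fun j : Fin N => dist (x j) (x i) ≤ R₁).image fun j => x j - x i)) → ∀ (δ θ : ℝ), (∀ (N : ℕ) (x : Fin N → EuclideanSpace ℝ (Fin 3)), Function.Injective x → (∀ i j, i ≠ j → δ ≤ dist (x i) (x j)) → ∑ i, τ ((Finset.univ.filter fun j : Fin N => dist (x j) (x i) ≤ R₁).image fun j => x j - x i) - ∑ i, siteEnergy (fun r => (r⁻¹) ^ 6) x i ≤ 12 * θ * (interactionEnergy lennardJones x - (N : ℝ) * ⨅ Q : PeriodicConfiguration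 3, Q.energyPerParticle lennardJones)) → 0 < R₁ ∧ (∀ d : ℝ, R₁ < d → (d⁻¹) ^ 6 ≤ τ {0}) ∧ τ {0} ≤ 12 * θ * -(⨅ Q : PeriodicConfiguration 3, Q.energyPerParticle lennardJones) ∧ (⨅ Q : PeriodicConfiguration 3, Q.energyPerParticle lennardJones) < 0 ∧ 0 < θ ∧ (R₁⁻¹) ^ 6 / (12 * -(⨅ Q : PeriodicConfiguration 3, Q.energyPerParticle lennardJones)) ≤ θ := by
  intro R₁ τ hDom δ θ hθ
  exact ⟨dom_R₁_pos hDom, fun d hd => dom_inv_pow_six_le_tau_zero hDom hd,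
    coercive_tau_zero_le hθ (dom_R₁_pos hDom).le, witness_eStar_neg hDom hθ,
    witness_theta_pos hDom hθ, witness_theta_ge hDom hθ⟩

end Summit.AtomisticToContinuum.Crystallization.Theorems.FluxCellKeplerSketchCoercive
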